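import Mathlib
import Summits.Ventures.PercRepro2.Tail2DBlockCalc
import Summits.Ventures.PercRepro2.Tail2DHarrisSP
import Summits.Ventures.PercRepro2.Tail2DFlowOneBlocks
import Summits.Ventures.PercRepro2.Tail2DFlowOneStep01
import Summits.Ventures.PercRepro2.Tail2DParFin
import Summits.Ventures.PercRepro2.Tail2DParFinFlip
import Summits.Ventures.PercRepro2.Tail2DParFinTop
import Summits.Ventures.PercRepro2.Tail2DParFinDiag
import Summits.Ventures.PercRepro2.Tail2DParFinCount
import Summits.Ventures.PercRepro2.Tail2DParFinRelax
import Summits.Ventures.PercRepro2.Tail2DParFinSubTop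
import Summits.Ventures.PercRepro2.Tail2DParFinSubTopB
import Summits.Ventures.PercRepro2.Tail2DParFinSubTopC
import Summits.Ventures.PercRepro2.Tail2DParFinSubTopD
import Summits.Ventures.PercRepro2.Tail2DParFinFibres
import Summits.Ventures.PercRepro2.Tail2DOneChange
import Summits.Ventures.PercRepro2.Tail2DOneChangeB
import Summits.Ventures.PercRepro2.Tail2DOneChangeC
import Summits.Ventures.PercRepro2.Tail2DSDomSwap
import Summits.Ventures.PercRepro2.Tail2DBlockCertP2P2
import Summits.Ventures.PercRepro2.Tail2DFlowOneAxis
import Summits.Ventures.PercRepro2.Tail2DAxisClass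
import Summits.Ventures.PercRepro2.Tail2DFourIdent

import Summits.Ventures.PercRepro2.Tail2DFiveIdent

/-!
# Five identical factors, part II: the `(3,0)` identities and the theorem `sdomZ_five_all`
(seat mine-b, cell pub-perc-repro2; conjectures/MINE-B.md §44)
-/

namespace Summit.Ventures.PercRepro2.Tail2D

open V2Closure Finset

section Five

variable {Y : V2Closure.SP}

/-- **the source identity** at `(3,0)` -/
theorem ratesB_srcOK (hR : 0 < (rSet Y).card) : (ratesB Y).SrcOK (fun _ => Y) 3 0 := by
  intro w hw
  have h3 := nR_add_nB_add_nC 5 w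
  have ha : (0 : ℚ) < aY Y := by unfold aY; exact_mod_cast hR
  have hc : (0 : ℚ) ≤ cY Y := by unfold cY; positivity
  have hD := d5b_pos hR
  have hsum : ∀ (φ : ℚ), ∑ i ∈ redSet 5 w, φ = (nR 5 w : ℚ) * φ := by
    intro φ; rw [Finset.sum_const, ← nR_eq_card_redSet, nsmul_eq_mul]
  have hι : ∀ w', (ratesB Y).ι w' = ιB Y (nR 5 w') (nB 5 w') := fun _ => rfl
  have hf : ∀ w' i, (ratesB Y).f w' i = fB Y (nR 5 w') (nB 5 w') := fun _ _ => rfl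
  have hx : ∀ w' i, (ratesB Y).x w' i = xB Y (nR 5 w') (nB 5 w') := fun _ _ => rfl
  simp only [gam_five, hι, hf, hx]
  have hcases : (nR 5 w = 3 ∧ nB 5 w = 0) ∨ (nR 5 w = 3 ∧ nB 5 w = 1) ∨ (nR 5 w = 3 ∧ nB 5 w = 2) ∨ (nR 5 w = 4 ∧ nB 5 w = 0) ∨ (nR 5 w = 4 ∧ nB 5 w = 1) ∨ (nR 5 w = 5 ∧ nB 5 w = 0) := by
    have := hw.1; omega
  have hcom : ocCom 5 3 0 w ↔ (3 ≤ nR 5 w ∧ 0 ≤ nB 5 w) ∧ 0 + 1 ≤ nB 5 w := Iff.rfl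
  rcases hcases with ⟨hr, hb⟩ | ⟨hr, hb⟩ | ⟨hr, hb⟩ | ⟨hr, hb⟩ | ⟨hr, hb⟩ | ⟨hr, hb⟩ <;>
  · simp only [hcom, hr, hb, hsum, ιB, fB, xB]
    norm_num
    try unfold d5b
    try field_simp
    try ring

/-- **the target identity** at `(3,0)` -/
theorem ratesB_tgtOK (hY : FlowOne Y) (hR : 0 < (rSet Y).card) : (ratesB Y).TgtOK (fun _ => Y) 3 0 := by
  intro w0 ht
  have h3 := nR_add_nB_add_nC 5 w0
  have ha : (0 : ℚ) < aY Y := by unfold aY; exact_mod_cast hR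
  have hc : (0 : ℚ) ≤ cY Y := by unfold cY; positivity
  have hD := d5b_pos hR
  rw [tailCount_five_30 hY, tailCount_five_21 hY]
  have hι : ∀ w', (ratesB Y).ι w' = ιB Y (nR 5 w') (nB 5 w') := fun _ => rfl
  have hf : ∀ w' i, (ratesB Y).f w' i = fB Y (nR 5 w') (nB 5 w') := fun _ _ => rfl
  have hx : ∀ w' i, (ratesB Y).x w' i = xB Y (nR 5 w') (nB 5 w') := fun _ _ => rfl
  simp only [hι, hf, hx]
  have hsumB : ∑ j ∈ blueSet 5 w0, (fB Y (nR 5 (Function.update w0 j Ltr.R)) (nB 5 (Function.update w0 j Ltr.R))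
      + (if ocCom 5 3 0 (Function.update w0 j Ltr.R)
          then xB Y (nR 5 (Function.update w0 j Ltr.R)) (nB 5 (Function.update w0 j Ltr.R)) else 0))
      = (nB 5 w0 : ℚ) * (fB Y (nR 5 w0 + 1) (nB 5 w0 - 1)
          + (if (3 ≤ nR 5 w0 + 1 ∧ 0 ≤ nB 5 w0 - 1) ∧ 0 + 1 ≤ nB 5 w0 - 1
            then xB Y (nR 5 w0 + 1) (nB 5 w0 - 1) else 0)) := by
    rw [nB_eq_card_blueSet, ← nsmul_eq_mul, ← Finset.sum_const]
    apply Finset.sum_congr rfl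
    intro j hj
    have hjB : w0 j = Ltr.B := by simpa [blueSet] using hj
    have e1 := nR_update_R 5 w0 j (by rw [hjB]; exact Ltr.noConfusion)
    have e2 := nB_update_R_of_B 5 w0 j hjB
    have e2' : nB 5 (Function.update w0 j Ltr.R) = nB 5 w0 - 1 := by omega
    have hcom : ocCom 5 3 0 (Function.update w0 j Ltr.R)
        ↔ (3 ≤ nR 5 (Function.update w0 j Ltr.R) ∧ 0 ≤ nB 5 (Function.update w0 j Ltr.R))
          ∧ 0 + 1 ≤ nB 5 (Function.update w0 j Ltr.R) := Iff.rfl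
    simp only [hcom, e1, e2']
    rw [nB_eq_card_blueSet]
  have hsumC : ∑ l ∈ cSet 5 w0, xB Y (nR 5 (Function.update w0 l Ltr.R)) (nB 5 (Function.update w0 l Ltr.R))
      = (nC 5 w0 : ℚ) * xB Y (nR 5 w0 + 1) (nB 5 w0) := by
    show _ = ((cSet 5 w0).card : ℚ) * _
    rw [← nsmul_eq_mul, ← Finset.sum_const]
    apply Finset.sum_congr rfl
    intro l hl
    have hlC : w0 l = Ltr.C := by simpa [cSet] using hl
    have e1 := nR_update_R 5 w0 l (by rw [hlC]; exact Ltr.noConfusion)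
    have e2 := nB_update_R_of_ne 5 w0 l (by rw [hlC]; exact Ltr.noConfusion)
    rw [e1, e2]
  rw [hsumB, hsumC]
  have hcases : (nR 5 w0 = 2 ∧ nB 5 w0 = 1) ∨ (nR 5 w0 = 2 ∧ nB 5 w0 = 2) ∨ (nR 5 w0 = 2 ∧ nB 5 w0 = 3) ∨ (nR 5 w0 = 3 ∧ nB 5 w0 = 1) ∨ (nR 5 w0 = 3 ∧ nB 5 w0 = 2) ∨ (nR 5 w0 = 4 ∧ nB 5 w0 = 1) := by
    have := ht.1; have := ht.2; omega
  have hcom : ocCom 5 3 0 w0 ↔ (3 ≤ nR 5 w0 ∧ 0 ≤ nB 5 w0) ∧ 0 + 1 ≤ nB 5 w0 := Iff.rfl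
  rcases hcases with ⟨hr, hb⟩ | ⟨hr, hb⟩ | ⟨hr, hb⟩ | ⟨hr, hb⟩ | ⟨hr, hb⟩ | ⟨hr, hb⟩ <;>
  · have hnC : nC 5 w0 = 5 - nR 5 w0 - nB 5 w0 := by omega
    simp only [hcom, hr, hb, hnC, ιB, fB, xB]
    norm_num
    try unfold d5b
    try field_simp
    try ring

/-- **(SD) at `(2,0)` on five identical factors** -/
theorem sdomZ_five_20 (hY : FlowOne Y) (hR : 0 < (rSet Y).card) : SDomZ (parFin 5 (fun _ => Y)) 2 0 :=
  sdomZ_of_oneChange (fun _ => hY) (fun _ => hR) (by norm_num) (ratesA Y) (ratesA_iota_nonneg hR)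
    (ratesA_f_nonneg hR) (ratesA_x_nonneg hR) (ratesA_srcOK hR) (ratesA_tgtOK hY hR)

/-- **(SD) at `(3,0)` on five identical factors** -/
theorem sdomZ_five_30 (hY : FlowOne Y) (hR : 0 < (rSet Y).card) : SDomZ (parFin 5 (fun _ => Y)) 3 0 :=
  sdomZ_of_oneChange (fun _ => hY) (fun _ => hR) (by norm_num) (ratesB Y) (ratesB_iota_nonneg hR)
    (ratesB_f_nonneg hR) (ratesB_x_nonneg hR) (ratesB_srcOK hR) (ratesB_tgtOK hY hR)

/-- `(1,1)` by the colour swap -/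
theorem sdomZ_five_11 (hY : FlowOne Y) (hR : 0 < (rSet Y).card) : SDomZ (parFin 5 (fun _ => Y)) 1 1 := by
  have h := sdomZ_five_20 hY hR
  rw [sdomZ_swap_iff] at h
  norm_num at h
  exact h

/-- `(1,2)` by the colour swap -/
theorem sdomZ_five_12 (hY : FlowOne Y) (hR : 0 < (rSet Y).card) : SDomZ (parFin 5 (fun _ => Y)) 1 2 := by
  have h := sdomZ_five_30 hY hR
  rw [sdomZ_swap_iff] at h
  norm_num at h
  exact h

/-- **(SD) at EVERY clipped position on `Y ∥ Y ∥ Y ∥ Y ∥ Y`** for any flow-one `Y` with a red crossing -/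
theorem sdomZ_five_all (hY : FlowOne Y) (hR : 0 < (rSet Y).card) (u v : ℤ) :
    SDomZ (parFin 5 (fun _ => Y)) u v := by
  have hX : ∀ i : Fin 5, FlowOne ((fun _ => Y) i) := fun _ => hY
  have hR' : ∀ i : Fin 5, 0 < (rSet ((fun _ => Y) i)).card := fun _ => hR
  by_cases haxis : u ≤ 0 ∨ v ≤ -1
  · exact sdomZ_axisComb_axis (axisComb_parFin 5 (fun _ => Y) (fun _ => ⟨hY, hR⟩)) u v haxis
  push Not at haxis
  obtain ⟨u', rfl⟩ : ∃ u' : ℕ, u = u' := ⟨u.toNat, by omega⟩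
  obtain ⟨v', rfl⟩ : ∃ v' : ℕ, v = v' := ⟨v.toNat, by omega⟩
  have hu : 1 ≤ u' := by omega
  by_cases hbig : 5 < u' + v'
  · apply sdomZ_of_tailCount_zero
    left
    rw [show ((u' : ℤ)).toNat = u' by omega, show ((v' : ℤ)).toNat = v' by omega]
    exact tailCount_parFin_eq_zero 5 _ hX u' v' hbig
  push Not at hbig
  rcases (show u' + v' = 5 ∨ u' + v' = 4 ∨ u' = v' + 1 ∨ (u' = 2 ∧ v' = 0) ∨ (u' = 1 ∧ v' = 1) ∨ (u' = 3 ∧ v' = 0)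
      ∨ (u' = 1 ∧ v' = 2) ∨ (u' = 1 ∧ v' = 0) by omega)
    with h | h | h | ⟨h1, h2⟩ | ⟨h1, h2⟩ | ⟨h1, h2⟩ | ⟨h1, h2⟩ | ⟨h1, h2⟩
  · have := sdomZ_parFin_top 5 (fun _ => Y) u' hX hu (by omega)
    rwa [show 5 - u' = v' by omega] at this
  · exact sdomZ_parFin_subtop_all 5 (fun _ => Y) u' v' hX hR' (by omega) hu
  · subst h
    have := sdomZ_parFin_diag 5 (fun _ => Y) (v' + 1) hX (by omega)
    push_cast at this
    simpa using this
  · subst h1; subst h2; exact sdomZ_five_20 hY hR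
  · subst h1; subst h2; exact sdomZ_five_11 hY hR
  · subst h1; subst h2; exact sdomZ_five_30 hY hR
  · subst h1; subst h2; exact sdomZ_five_12 hY hR
  · subst h1; subst h2; exact sdomZ_of_le_one _ _ _ (by norm_num) (by norm_num)

end Five

end Summit.Ventures.PercRepro2.Tail2D
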